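import Summits.BirchSwinnertonDyer.BirchSwinnertonDyer.Theorems.ClassRecordThreeEulerHalvesAtThreeCartanCoverInertHecke
import Summits.BirchSwinnertonDyer.BirchSwinnertonDyer.Theorems.ClassRecordThreeEulerHalvesAtThreeCartanCoverHeckePeriods
import Summits.BirchSwinnertonDyer.BirchSwinnertonDyer.Theorems.ClassRecordThreeEulerHalvesAtThreeCartanCoverDockedLineSaturation
import HarnessLib

/-!
# Hecke operators on additive cochains — the generic layer of the inert-Hecke certificate for (OBS) `CartanCover.Charext.NoModThreePeriodCharacterExtension`

Support file for crux `CartanOnePlaceDegreeLawAtThree` (item stmt-BirchSwinnertonDyer-24801; lines `Lines/lattice` v6 ∕ `Lines/charext` v10, shared Galois leaf (OBS)).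
Source: `Cruxes/CartanOnePlaceDegreeLawAtThree/Lines/charext.lean` v10 §InertHecke (crux ideator cruxidea-24801-1 g0, 2026-08-29), SORRY-FREE. Contents:
`HeckeDatum Γ ι` (representatives `α`, coset permutations `σ`, `mem`, `disj`; `σ_unique ∕ σ_mul ∕ σ_one ∕ σ_eq_self_of_comm`; `ofStable`; `op χ γ = Σ_i χ(α i γ α(σ γ i)⁻¹)`) with
(T1) `op_mul`, (T2) `op_apply_of_normalised`, (T2′) `restrict ∕ op_restrict ∕ memN_of_reduction`, (T8) `changeReps ∕ op_changeReps`, (T9) `exists_changeReps_commonReduction`,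
(T3) `op_apply_eq_zero_of_cube_central`, (T4) `apply_eq_zero_of_eigen`, (T5) `eigen_of_eigen_on`; (T6) `fixedPointFree_of_projective_equivariance` (+ `ne_one_of_sq_add_self_add_one_eq_zero`,
`cube_eq_one_of_sq_add_self_add_one_eq_zero`); (T7) `gammaHeckeDatum X n` + `period_op_eq_smul` (the Hecke–period identity `period_smul_eq_sum` through `op`); (T10) `unitsHeckeSet ∕
unitsHeckeSetoid ∕ units_exists_perm_mul ∕ unitsHeckeDatum` for the norm-one group of any order and `coverHeckeDatum X q n : HeckeDatum (coverUnits X q) _`.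
Uses the landed bricks `sum_eq_zero_of_three_cycles`, `no_eigenvector_of_cube_eq_one`, `modThree_trivial_of_trivial_on_principalLevel` (p737917) and (M0)'s Prop
`CartanCover.Charext.StrongApproxAtCartanPlace` (p738423) by name. Nothing here is specific to a curve; BSD is proved for no curve.
-/

noncomputable section

open scoped Classical Pointwise MatrixGroups UpperHalfPlane

namespace Summit.BirchSwinnertonDyer.BirchSwinnertonDyer.Theorems.CartanCover.Charext

open Literature.NumberTheory.Automorphic

section D3Lemmas

variable {Γ : Subgroup (GL (Fin 2) ℝ)} [Γ.HasDetOne]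

/-- Elements of `Γ ≤ SL₂(ℝ)` have positive determinant.
-- adapted from Literature/NumberTheory/Automorphic/ShimuraCurvePeriodsHeckeIntegralityProofs.lean §2 (no hub olean in this closure) [folklore] -/
theorem det_val_pos_of_mem' {γ : GL (Fin 2) ℝ} (hγ : γ ∈ Γ) : 0 < γ.det.val := by
  rw [Subgroup.HasDetOne.det_eq hγ, Units.val_one]; exact one_pos

/-- `Γ`-invariance of segment integrals: `∫_{γz}^{γw} h = ∫_z^w h`. [folklore] -/
theorem segmentIntegral_smul_smul' (h : CuspForm Γ 2) {γ : GL (Fin 2) ℝ} (hγ : γ ∈ Γ) (z w : ℍ) :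
    segmentIntegral h (γ • z) (γ • w) = segmentIntegral h z w := by
  have e := CartanDegree.segmentIntegral_slash_inv_smul h (det_val_pos_of_mem' hγ) (γ • z) w
  rw [SlashInvariantForm.slash_action_eqn h γ hγ, inv_smul_smul] at e
  exact e.symm

/-- The period `∫_τ^{γτ} h` does not depend on the base point. [folklore] -/
theorem period_eq_period' (h : CuspForm Γ 2) {γ : GL (Fin 2) ℝ} (hγ : γ ∈ Γ) (z w : ℍ) :
    segmentIntegral h z (γ • z) = segmentIntegral h w (γ • w) := by
  have e1 := segmentIntegral_sub_segmentIntegral h w z (γ • z)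
  have e2 := segmentIntegral_sub_segmentIntegral h w (γ • w) (γ • z)
  have e3 := segmentIntegral_smul_smul' h hγ w z
  linear_combination (-1 : ℂ) * e1 + e2 + e3

omit [Γ.HasDetOne] in
/-- `∫_z^z h = 0`. [folklore] -/
theorem period_one' (h : CuspForm Γ 2) (z : ℍ) : segmentIntegral h z ((1 : GL (Fin 2) ℝ) • z) = 0 := by
  have e := segmentIntegral_sub_segmentIntegral h z z z
  rw [sub_self] at e
  rw [one_smul]
  exact e.symm

/-- Additivity of periods: `γ ↦ ∫_z^{γz} h` is a homomorphism on `Γ`. [folklore] -/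
theorem period_mul' (h : CuspForm Γ 2) {γ : GL (Fin 2) ℝ} (hγ : γ ∈ Γ) (δ : GL (Fin 2) ℝ) (z : ℍ) :
    segmentIntegral h z ((γ * δ) • z) = segmentIntegral h z (γ • z) + segmentIntegral h z (δ • z) := by
  have e1 := segmentIntegral_sub_segmentIntegral h z (δ • z) ((γ * δ) • z)
  have e2 : segmentIntegral h (δ • z) ((γ * δ) • z) = segmentIntegral h z (γ • z) := by
    rw [mul_smul]; exact (period_eq_period' h hγ z (δ • z)).symm
  linear_combination e1 + e2

/-- Periods at inverses. [folklore] -/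
theorem period_inv' (h : CuspForm Γ 2) {γ : GL (Fin 2) ℝ} (hγ : γ ∈ Γ) (z : ℍ) :
    segmentIntegral h z (γ⁻¹ • z) = -segmentIntegral h z (γ • z) := by
  have e := period_mul' h (inv_mem hγ) γ z
  rw [inv_mul_cancel, period_one'] at e
  linear_combination -e

/-- Periods at integer powers: `∫_z^{γᵏ z} h = k · ∫_z^{γ z} h`. [folklore] -/
theorem period_zpow (h : CuspForm Γ 2) {γ : GL (Fin 2) ℝ} (hγ : γ ∈ Γ) (z : ℍ) (k : ℤ) :
    segmentIntegral h z ((γ ^ k) • z) = (k : ℂ) * segmentIntegral h z (γ • z) := by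
  induction k using Int.induction_on with
  | zero => rw [zpow_zero, period_one', Int.cast_zero, zero_mul]
  | succ n ih =>
      rw [zpow_add_one, period_mul' h (Subgroup.zpow_mem Γ hγ n) γ z, ih]
      push_cast; ring
  | pred n ih =>
      rw [zpow_sub_one, period_mul' h (Subgroup.zpow_mem Γ hγ _) γ⁻¹ z, ih, period_inv' h hγ z]
      push_cast; ring

end D3Lemmas

namespace InertHecke

/-! (v10) the v8.1 bricks β₁ `no_eigenvector_of_cube_eq_one`, β₂ `sum_eq_zero_of_three_cycles` ∕ `hecke_sum_eq_zero_of_three_cycles[_central]`, CHEB `exists_det_neg_one_trace_ne_zero`,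
the unipotent factorisation `exists_unip_factorization`, `additive_trivial_of_trivial_on_ker` and (RES-INJ) `modThree_trivial_of_trivial_on_principalLevel` are TREE THEOREMS now
(LEAD tam3-p1 g27, p737917 `…CartanCoverInertHecke`, namespace `CartanCover.Charext.InertHecke`) and are used BY NAME below. What this section adds (v9.1–v9.5, not yet in Theorems):
`HeckeDatum` with (T1) `op_mul`, (T2) `op_apply_of_normalised`, (T2′) `restrict` ∕ `op_restrict` ∕ `memN_of_reduction`, (T3) `op_apply_eq_zero_of_cube_central`, (T4) `apply_eq_zero_of_eigen`,
`ofStable`, (T5) `eigen_of_eigen_on`, (T6) `fixedPointFree_of_projective_equivariance` (+ `ne_one_…`, `cube_eq_one_…`), (T7) `gammaHeckeDatum` ∕ `period_op_eq_smul`. -/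


/-! #### (T6) fixed-point-freeness of elliptic order-3 elements on `ℙ¹(𝔽_ℓ)`-indexed cosets — PROVED (v9.3) -/

/-- **(T6) fixed-point-freeness from projective equivariance**: if the coset permutation `τ` of `x` is intertwined, up to non-zero scalars, with the action of a matrix
`x̄ ∈ M₂(𝔽_ℓ)` (`x̄³ = 1`, `x̄ ≠ 1`, `ℓ ≡ 2 (mod 3)`) on non-zero vectors — `x̄ · e i = c_i · e (τ i)` — then `τ` has no fixed point: a fixed coset would be an
`x̄`-stable line, i.e. an eigenvector, excluded by `no_eigenvector_of_cube_eq_one`. (The intertwining map `e : ι → 𝔽_ℓ² ∖ 0` is the identification of the `ℓ + 1` cosets of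
`T_ℓ` with `ℙ¹(𝔽_ℓ)`.) [folklore] -/
theorem fixedPointFree_of_projective_equivariance {ℓ : ℕ} [Fact ℓ.Prime] (hℓ : ℓ % 3 = 2)
    (xbar : Matrix (Fin 2) (Fin 2) (ZMod ℓ)) (hx3 : xbar ^ 3 = 1) (hx1 : xbar ≠ 1)
    {ι : Type*} (τ : ι → ι) (e : ι → (Fin 2 → ZMod ℓ)) (he : ∀ i, e i ≠ 0)
    (hequi : ∀ i, ∃ c : ZMod ℓ, xbar.mulVec (e i) = c • e (τ i)) :
    ∀ i, τ i ≠ i := by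
  intro i hi
  obtain ⟨c, hc⟩ := hequi i
  rw [hi] at hc
  exact no_eigenvector_of_cube_eq_one hℓ xbar hx3 hx1 ⟨c, e i, he i, hc⟩

/-- the reduction of an elliptic element of order `3` is never `1 (mod ℓ)` for `ℓ ≠ 3`… in the abstract form the certificate uses: if `x̄ = 1` then `x̄² + x̄ + 1 = 3 = 0`
in `M₂(𝔽_ℓ)`, forcing `ℓ ∣ 3`. -/
theorem ne_one_of_sq_add_self_add_one_eq_zero {ℓ : ℕ} [Fact ℓ.Prime] (hℓ3 : ℓ ≠ 3)
    (xbar : Matrix (Fin 2) (Fin 2) (ZMod ℓ)) (hmin : xbar ^ 2 + xbar + 1 = 0) : xbar ≠ 1 := by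
  intro h
  rw [h, one_pow] at hmin
  have e := congrArg (fun m : Matrix (Fin 2) (Fin 2) (ZMod ℓ) => m 0 0) hmin
  simp only [Matrix.add_apply, Matrix.one_apply_eq, Matrix.zero_apply] at e
  have h3' : ((3 : ℕ) : ZMod ℓ) = 0 := by
    rw [← e]; norm_num
  rw [ZMod.natCast_eq_zero_iff] at h3'
  have hp : ℓ.Prime := Fact.out
  have := (Nat.prime_dvd_prime_iff_eq hp Nat.prime_three).mp h3'
  exact hℓ3 this

/-- … and `x̄² + x̄ + 1 = 0` gives `x̄³ = 1`. -/
theorem cube_eq_one_of_sq_add_self_add_one_eq_zero {R : Type*} [Ring R] (x : R) (hmin : x ^ 2 + x + 1 = 0) : x ^ 3 = 1 := by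
  have : x ^ 3 - 1 = (x - 1) * (x ^ 2 + x + 1) := by noncomm_ring
  rw [hmin, mul_zero, sub_eq_zero] at this
  exact this


/-! #### (HECKE-ABS) Hecke operators on additive cochains — additivity, restriction, vanishing at elliptic 3-cycle elements, eigen ⇒ vanishing — PROVED (v9.1) -/

/-- **Hecke datum** on a subgroup `Γ ≤ 𝔾`: finitely many representatives `α i` of the right cosets `Γ α i` of a `Γ`-stable finite union `⋃ Γ α i` (a double coset
`Γ α Γ`), pairwise `Γ`-inequivalent (`disj`), with the coset permutation `σ γ` of each `γ ∈ Γ` (`mem`: `α i · γ ∈ Γ · α (σ γ i)`). [folklore] -/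
structure HeckeDatum {𝔾 : Type*} [Group 𝔾] (Γ : Subgroup 𝔾) (ι : Type*) where
  α : ι → 𝔾
  σ : Γ → Equiv.Perm ι
  mem : ∀ (γ : Γ) (i : ι), α i * γ * (α (σ γ i))⁻¹ ∈ Γ
  disj : ∀ (i j : ι) (g : 𝔾), g ∈ Γ → α i = g * α j → i = j

namespace HeckeDatum

variable {𝔾 : Type*} [Group 𝔾] {Γ : Subgroup 𝔾} {ι : Type*} (H : HeckeDatum Γ ι)

/-- uniqueness of the coset permutation. -/
theorem σ_unique (γ : Γ) (i j : ι) (h : H.α i * γ * (H.α j)⁻¹ ∈ Γ) : j = H.σ γ i := by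
  have h' := H.mem γ i
  -- (α i γ α j⁻¹)⁻¹ * (α i γ α (σ γ i)⁻¹) = α j * α (σ γ i)⁻¹ ∈ Γ
  have hq : H.α j * (H.α (H.σ γ i))⁻¹ ∈ Γ := by
    have := Γ.mul_mem (Γ.inv_mem h) h'
    have e : (H.α i * γ * (H.α j)⁻¹)⁻¹ * (H.α i * γ * (H.α (H.σ γ i))⁻¹) = H.α j * (H.α (H.σ γ i))⁻¹ := by group
    rwa [e] at this
  exact H.disj j (H.σ γ i) _ hq (by group)

theorem σ_mul (γ δ : Γ) (i : ι) : H.σ (γ * δ) i = H.σ δ (H.σ γ i) := by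
  symm
  apply H.σ_unique (γ * δ) i
  have e : H.α i * ((γ * δ : Γ) : 𝔾) * (H.α (H.σ δ (H.σ γ i)))⁻¹
      = (H.α i * γ * (H.α (H.σ γ i))⁻¹) * (H.α (H.σ γ i) * δ * (H.α (H.σ δ (H.σ γ i)))⁻¹) := by
    rw [Subgroup.coe_mul]; group
  rw [e]; exact Γ.mul_mem (H.mem γ i) (H.mem δ (H.σ γ i))

theorem σ_one (i : ι) : H.σ 1 i = i := by
  symm; apply H.σ_unique 1 i i
  rw [Subgroup.coe_one, mul_one, mul_inv_cancel]; exact Γ.one_mem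

/-- an element `c ∈ Γ` commuting with every representative has trivial coset permutation. -/
theorem σ_eq_self_of_comm (c : Γ) (hc : ∀ i, H.α i * c = c * H.α i) (i : ι) : H.σ c i = i := by
  symm; apply H.σ_unique c i i
  rw [hc, mul_assoc, mul_inv_cancel, mul_one]; exact c.2

/-- **constructor from stability**: pairwise `Γ`-inequivalent representatives `α : ι → 𝔾` (finite `ι`) of a right-`Γ`-stable union of cosets (`stab`: every `α i · γ` lies in
some `Γ · α j`) carry a (unique) Hecke datum — the coset map is injective by `disj`, hence a permutation of the finite `ι`. [folklore] -/
noncomputable def ofStable [Finite ι] (α : ι → 𝔾) (disj : ∀ (i j : ι) (g : 𝔾), g ∈ Γ → α i = g * α j → i = j)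
    (stab : ∀ (γ : Γ) (i : ι), ∃ j, α i * γ * (α j)⁻¹ ∈ Γ) : HeckeDatum Γ ι := by
  classical
  let f : Γ → ι → ι := fun γ i => (stab γ i).choose
  have hf : ∀ γ i, α i * γ * (α (f γ i))⁻¹ ∈ Γ := fun γ i => (stab γ i).choose_spec
  have hinj : ∀ γ, Function.Injective (f γ) := by
    intro γ i i' h
    -- α i γ α j⁻¹ ∈ Γ and α i' γ α j⁻¹ ∈ Γ with j = f γ i = f γ i' ⇒ α i α i'⁻¹ ∈ Γ
    have h1 := hf γ i; have h2 := hf γ i'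
    rw [h] at h1
    have h3 : α i * (α i')⁻¹ ∈ Γ := by
      have := Γ.mul_mem h1 (Γ.inv_mem h2)
      have e : α i * γ * (α (f γ i'))⁻¹ * (α i' * γ * (α (f γ i'))⁻¹)⁻¹ = α i * (α i')⁻¹ := by group
      rwa [e] at this
    exact disj i i' _ h3 (by group)
  exact
    { α := α
      σ := fun γ => Equiv.ofBijective (f γ) (Finite.injective_iff_bijective.mp (hinj γ))
      mem := fun γ i => hf γ i
      disj := disj }

@[simp] theorem ofStable_α [Finite ι] (α : ι → 𝔾) (disj) (stab : ∀ (γ : Γ) (i : ι), ∃ j, α i * γ * (α j)⁻¹ ∈ Γ) :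
    (ofStable α disj stab).α = α := by
  classical
  unfold ofStable; rfl

variable {A : Type*} [AddCommGroup A] [Fintype ι]

/-- the Hecke operator on cochains: `(T χ)(γ) = Σ_i χ(α i · γ · α (σ γ i)⁻¹)`. -/
def op (χ : Γ → A) : Γ → A := fun γ => ∑ i, χ ⟨H.α i * γ * (H.α (H.σ γ i))⁻¹, H.mem γ i⟩

theorem op_apply (χ : Γ → A) (γ : Γ) : H.op χ γ = ∑ i, χ ⟨H.α i * γ * (H.α (H.σ γ i))⁻¹, H.mem γ i⟩ := rfl

/-- **(T1) additivity**: the Hecke operator preserves additive cochains (homomorphisms `Γ → A`). [folklore] -/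
theorem op_mul (χ : Γ → A) (hχ : ∀ a b : Γ, χ (a * b) = χ a + χ b) (γ δ : Γ) :
    H.op χ (γ * δ) = H.op χ γ + H.op χ δ := by
  classical
  rw [op_apply, op_apply, op_apply]
  have key : ∀ i, χ ⟨H.α i * ((γ * δ : Γ) : 𝔾) * (H.α (H.σ (γ * δ) i))⁻¹, H.mem (γ * δ) i⟩
      = χ ⟨H.α i * γ * (H.α (H.σ γ i))⁻¹, H.mem γ i⟩ + χ ⟨H.α (H.σ γ i) * δ * (H.α (H.σ δ (H.σ γ i)))⁻¹, H.mem δ (H.σ γ i)⟩ := by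
    intro i
    rw [← hχ]; congr 1; apply Subtype.ext
    simp only [Subgroup.coe_mul, H.σ_mul]; group
  rw [Finset.sum_congr rfl (fun i _ => key i), Finset.sum_add_distrib]
  congr 1
  exact Equiv.sum_comp (H.σ γ) (fun j => χ ⟨H.α j * δ * (H.α (H.σ δ j))⁻¹, H.mem δ j⟩)

/-- **(T2) normalised elements**: on an element `β` NORMALISED INTO `Γ` by every representative (`α i β α i⁻¹ ∈ Γ`), the coset
permutation is trivial and `(T χ)(β) = Σ_i χ(α i β α i⁻¹)`. (CAVEAT, v9.5: for `N = Γ̄(q)` and `α i` of norm `ℓ` this hypothesis is NOT met — `α i β α i⁻¹` is not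
`ℓ`-integral in general and `σ β` acts on the cosets through `β mod ℓ`; the compatibility `res ∘ T_Γ = T_N ∘ res` actually used is (T2′) `op_restrict` below, whose hypothesis
`α i β α(σ β i)⁻¹ ∈ N` is supplied by `memN_of_reduction` from representatives with a COMMON reduction mod `q`, arranged via (M0).) [folklore] -/
theorem op_apply_of_normalised (χ : Γ → A) (β : Γ) (hβ : ∀ i, H.α i * β * (H.α i)⁻¹ ∈ Γ) :
    H.op χ β = ∑ i, χ ⟨H.α i * β * (H.α i)⁻¹, hβ i⟩ := by
  classical
  rw [op_apply]
  apply Finset.sum_congr rfl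
  intro i _
  have hi : H.σ β i = i := (H.σ_unique β i i (hβ i)).symm
  congr 1; apply Subtype.ext; simp only [hi]

/-- **(T2′) restriction to a subgroup served by the same representatives**: if for `β ∈ N ≤ Γ` the elements `α i · β · α (σ β i)⁻¹` lie in `N` (not only in `Γ`) — i.e.
`N α N = ⊔ N α i` with the SAME representatives — the datum restricts to `N` (same `α`, same coset permutations). [cite: ShimuraIATAF1971, §3.3–3.4] -/
def restrict (N : Subgroup 𝔾) (hN : N ≤ Γ) (memN : ∀ (β : N) (i : ι), H.α i * β * (H.α (H.σ ⟨β, hN β.2⟩ i))⁻¹ ∈ N) : HeckeDatum N ι where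
  α := H.α
  σ := fun β => H.σ ⟨β, hN β.2⟩
  mem := memN
  disj := fun i j g hg h => H.disj i j g (hN hg) h

/-- `res ∘ T_Γ = T_N ∘ res`: on `β ∈ N` the Hecke operator of `Γ` IS the Hecke operator of the restricted datum applied to the restricted cochain (definitionally).
[cite: ShimuraIATAF1971, §3.4] -/
theorem op_restrict (N : Subgroup 𝔾) (hN : N ≤ Γ) (memN : ∀ (β : N) (i : ι), H.α i * β * (H.α (H.σ ⟨β, hN β.2⟩ i))⁻¹ ∈ N)
    (χ : Γ → A) (β : N) :
    H.op χ ⟨β, hN β.2⟩ = (H.restrict N hN memN).op (fun x : N => χ ⟨x, hN x.2⟩) β := by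
  rw [op_apply, op_apply]; rfl

omit [Fintype ι] in
/-- **criterion for (T2′) via a reduction map**: if `Γ` and all representatives lie in a subgroup `𝔾'` carrying a homomorphism `r : 𝔾' → Q` (reduction `mod q`), `N = Γ ∩ ker r`,
and ALL REPRESENTATIVES HAVE THE SAME REDUCTION (`r (α i) = r (α j)` — arranged by left-multiplying the `α i` by elements of `Γ`, which is possible as soon as `r(Γ)`
contains the quotients `r(α i) r(α j)⁻¹`: for `Γ = ι(O₀'¹)` and `r = red`, these have determinant `1` and (M0) `red(Γ) = SL₂(𝔽_q)` supplies them), then the same representatives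
serve `N`: `α i β α (σ β i)⁻¹ ∈ N` for `β ∈ N`. [folklore] -/
theorem memN_of_reduction {𝔾' : Subgroup 𝔾} {Q : Type*} [Group Q] (r : 𝔾' →* Q) (hΓ : Γ ≤ 𝔾') (hα : ∀ i, H.α i ∈ 𝔾')
    (N : Subgroup 𝔾) (hNΓ : N ≤ Γ) (hN : ∀ (g : 𝔾) (hg : g ∈ Γ), g ∈ N ↔ r ⟨g, hΓ hg⟩ = 1)
    (hconst : ∀ i j, r ⟨H.α i, hα i⟩ = r ⟨H.α j, hα j⟩) :
    ∀ (β : N) (i : ι), H.α i * β * (H.α (H.σ ⟨β, hNΓ β.2⟩ i))⁻¹ ∈ N := by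
  intro β i
  set γ : Γ := ⟨β, hNΓ β.2⟩ with hγ
  have hδΓ : H.α i * β * (H.α (H.σ γ i))⁻¹ ∈ Γ := H.mem γ i
  rw [hN _ hδΓ]
  have hβ1 : r ⟨(β : 𝔾), hΓ (hNΓ β.2)⟩ = 1 := (hN (β : 𝔾) (hNΓ β.2)).mp β.2
  have e : (⟨H.α i * β * (H.α (H.σ γ i))⁻¹, hΓ hδΓ⟩ : 𝔾') = ⟨H.α i, hα i⟩ * ⟨(β : 𝔾), hΓ (hNΓ β.2)⟩ * ⟨H.α (H.σ γ i), hα _⟩⁻¹ := by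
    apply Subtype.ext; simp only [Subgroup.coe_mul, Subgroup.coe_inv]
  rw [e, map_mul, map_mul, map_inv, hβ1, mul_one, hconst i (H.σ γ i), mul_inv_cancel]

/-- **(T8) change of representatives**: replacing `α i` by `g i · α i` (`g i ∈ Γ`) gives a Hecke datum with the same coset permutations. [folklore] -/
def changeReps (g : ι → Γ) : HeckeDatum Γ ι where
  α := fun i => (g i : 𝔾) * H.α i
  σ := H.σ
  mem := by
    intro γ i
    have h := H.mem γ i
    have e : (g i : 𝔾) * H.α i * γ * ((g (H.σ γ i) : 𝔾) * H.α (H.σ γ i))⁻¹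
        = g i * (H.α i * γ * (H.α (H.σ γ i))⁻¹) * ((g (H.σ γ i) : 𝔾))⁻¹ := by group
    rw [e]
    exact Γ.mul_mem (Γ.mul_mem (g i).2 h) (Γ.inv_mem (g _).2)
  disj := by
    intro i j x hx h
    apply H.disj i j ((g i : 𝔾)⁻¹ * x * g j) (Γ.mul_mem (Γ.mul_mem (Γ.inv_mem (g i).2) hx) (g j).2)
    calc H.α i = (g i : 𝔾)⁻¹ * ((g i : 𝔾) * H.α i) := by group
      _ = (g i : 𝔾)⁻¹ * (x * ((g j : 𝔾) * H.α j)) := by rw [h]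
      _ = (g i : 𝔾)⁻¹ * x * g j * H.α j := by group

/-- **the Hecke operator does not depend on the representatives** (for additive cochains). [cite: ShimuraIATAF1971, §3.4 / §8.3] -/
theorem op_changeReps (g : ι → Γ) (χ : Γ → A) (hχ : ∀ a b : Γ, χ (a * b) = χ a + χ b) (γ : Γ) :
    (H.changeReps g).op χ γ = H.op χ γ := by
  classical
  have hχ1 : χ 1 = 0 := by
    have h := hχ 1 1; rw [mul_one] at h
    have h' : χ 1 + χ 1 = χ 1 + 0 := by rw [add_zero]; exact h.symm
    exact add_left_cancel h'
  have hχinv : ∀ a : Γ, χ a⁻¹ = -χ a := by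
    intro a; have := hχ a a⁻¹; rw [mul_inv_cancel, hχ1] at this; exact (neg_eq_of_add_eq_zero_right this.symm).symm
  rw [op_apply, op_apply]
  have key : ∀ i, χ ⟨(H.changeReps g).α i * γ * ((H.changeReps g).α ((H.changeReps g).σ γ i))⁻¹, (H.changeReps g).mem γ i⟩
      = χ (g i) + χ ⟨H.α i * γ * (H.α (H.σ γ i))⁻¹, H.mem γ i⟩ - χ (g (H.σ γ i)) := by
    intro i
    have e : (⟨(H.changeReps g).α i * γ * ((H.changeReps g).α ((H.changeReps g).σ γ i))⁻¹, (H.changeReps g).mem γ i⟩ : Γ)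
        = g i * ⟨H.α i * γ * (H.α (H.σ γ i))⁻¹, H.mem γ i⟩ * (g (H.σ γ i))⁻¹ := by
      apply Subtype.ext
      simp only [changeReps, Subgroup.coe_mul, Subgroup.coe_inv]
      group
    rw [e, hχ, hχ, hχinv, sub_eq_add_neg]
  rw [Finset.sum_congr rfl (fun i _ => key i), Finset.sum_sub_distrib, Finset.sum_add_distrib,
    Equiv.sum_comp (H.σ γ) (fun j => χ (g j))]
  abel

omit [Fintype ι] in
/-- **(T9) common reduction of the representatives**: if the quotients `r(α i₀) r(α i)⁻¹` of the reductions are reductions of elements of `Γ` (for `Γ = ι(O₀'¹)`, `r = red`: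
they have determinant `1`, and (M0) `red(Γ) = SL₂(𝔽_q)`), then after a change of representatives all `α i` have the reduction of `α i₀`. [folklore] -/
theorem exists_changeReps_commonReduction {𝔾' : Subgroup 𝔾} {Q : Type*} [Group Q] (r : 𝔾' →* Q) (hΓ : Γ ≤ 𝔾')
    (hα : ∀ i, H.α i ∈ 𝔾') (i₀ : ι)
    (hhit : ∀ i, ∃ (γ : 𝔾) (hγ : γ ∈ Γ), r ⟨γ, hΓ hγ⟩ = r ⟨H.α i₀, hα i₀⟩ * (r ⟨H.α i, hα i⟩)⁻¹) :
    ∃ g : ι → Γ, ∀ i, r ⟨(g i : 𝔾) * H.α i, 𝔾'.mul_mem (hΓ (g i).2) (hα i)⟩ = r ⟨H.α i₀, hα i₀⟩ := by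
  choose γ hγ hr using hhit
  refine ⟨fun i => ⟨γ i, hγ i⟩, fun i => ?_⟩
  have e : (⟨γ i * H.α i, 𝔾'.mul_mem (hΓ (hγ i)) (hα i)⟩ : 𝔾') = ⟨γ i, hΓ (hγ i)⟩ * ⟨H.α i, hα i⟩ := by
    apply Subtype.ext; simp only [Subgroup.coe_mul]
  simp only [e, map_mul, hr, inv_mul_cancel_right]

/-- **(T3) vanishing at elliptic `3`-cycle elements**: if `x³ = c` with `c` central in `𝔾` and `χ`-null, and the coset permutation of `x` is fixed-point-free, then
`(T χ)(x) = 0` for every additive `χ`. (`(σ x)³ = σ (x³) = σ c = 1` is automatic.) [folklore] -/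
theorem op_apply_eq_zero_of_cube_central [DecidableEq ι] (χ : Γ → A) (hχ : ∀ a b : Γ, χ (a * b) = χ a + χ b)
    (x c : Γ) (hx : x ^ 3 = c) (hc : ∀ g : 𝔾, g * c = c * g) (hχc : χ c = 0) (hfix : ∀ i, H.σ x i ≠ i) :
    H.op χ x = 0 := by
  classical
  have hσ3 : H.σ x ^ 3 = 1 := by
    ext i
    have e3 : (H.σ x ^ 3) i = H.σ (x ^ 3) i := by
      simp only [pow_succ, pow_zero, one_mul, Equiv.Perm.mul_apply, H.σ_mul]
    rw [e3, hx, H.σ_eq_self_of_comm c (fun j => hc (H.α j)) i, Equiv.Perm.one_apply]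
  have hσ3i : ∀ i, H.σ x (H.σ x (H.σ x i)) = i := by
    intro i
    have := congrArg (fun τ : Equiv.Perm ι => τ i) hσ3
    simpa [pow_succ, Equiv.Perm.mul_apply] using this
  rw [op_apply]
  refine sum_eq_zero_of_three_cycles (H.σ x) hfix hσ3 _ (fun i => ?_)
  rw [← hχ, ← hχ]
  have : (⟨H.α i * x * (H.α (H.σ x i))⁻¹, H.mem x i⟩ : Γ) * ⟨H.α (H.σ x i) * x * (H.α (H.σ x (H.σ x i)))⁻¹, H.mem x (H.σ x i)⟩ *
      ⟨H.α (H.σ x (H.σ x i)) * x * (H.α (H.σ x (H.σ x (H.σ x i))))⁻¹, H.mem x (H.σ x (H.σ x i))⟩ = c := by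
    apply Subtype.ext
    simp only [Subgroup.coe_mul, hσ3i]
    have hx' : (x : 𝔾) * x * x = c := by rw [← Subgroup.coe_mul, ← Subgroup.coe_mul, ← hx, pow_succ, pow_two]
    calc H.α i * x * (H.α (H.σ x i))⁻¹ * (H.α (H.σ x i) * x * (H.α (H.σ x (H.σ x i)))⁻¹) * (H.α (H.σ x (H.σ x i)) * x * (H.α i)⁻¹)
        = H.α i * ((x : 𝔾) * x * x) * (H.α i)⁻¹ := by group
      _ = c := by rw [hx', hc, mul_assoc, mul_inv_cancel, mul_one]
  rw [this, hχc]

/-- **(T4) eigen-cochains vanish at elliptic `3`-cycle elements when the eigenvalue is prime to `3`**: `T χ = a χ` pointwise, `3χ = 0`, `3 ∤ a` ⇒ `χ(x) = 0`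
for every `x` as in (T3). [folklore] -/
theorem apply_eq_zero_of_eigen [DecidableEq ι] (χ : Γ → A) (hχ : ∀ a b : Γ, χ (a * b) = χ a + χ b) (h3 : ∀ γ, 3 • χ γ = 0)
    (a : ℤ) (ha : ¬ (3 : ℤ) ∣ a) (heig : ∀ γ, H.op χ γ = a • χ γ)
    (x c : Γ) (hx : x ^ 3 = c) (hc : ∀ g : 𝔾, g * c = c * g) (hχc : χ c = 0) (hfix : ∀ i, H.σ x i ≠ i) :
    χ x = 0 := by
  have h0 : a • χ x = 0 := by rw [← heig]; exact H.op_apply_eq_zero_of_cube_central χ hχ x c hx hc hχc hfix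
  have h3x : (3 : ℤ) • χ x = 0 := by rw [show (3 : ℤ) = ((3 : ℕ) : ℤ) from rfl, natCast_zsmul]; exact h3 x
  -- Bezout: gcd(a, 3) = 1
  have hcop : IsCoprime a 3 := by
    rw [Int.isCoprime_iff_gcd_eq_one]
    have h := Int.gcd_dvd_right a 3
    have h1 : Int.gcd a 3 ∣ 3 := by exact_mod_cast h
    rcases (Nat.dvd_prime Nat.prime_three).mp h1 with h2 | h2
    · exact h2
    · exfalso; apply ha
      have := Int.gcd_dvd_left a 3
      rw [h2] at this; exact_mod_cast this
  obtain ⟨u, v, huv⟩ := hcop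
  calc χ x = (1 : ℤ) • χ x := (one_zsmul _).symm
    _ = (u * a + v * 3) • χ x := by rw [huv]
    _ = 0 := by rw [add_zsmul, mul_zsmul, mul_zsmul, h0, h3x, zsmul_zero, zsmul_zero, add_zero]

/-- **(T5) eigen-transfer through a res-injective subgroup**: if every additive `3`-torsion cochain on `Γ` vanishing on the set `N` vanishes identically (RES-INJ), and the
additive `3`-torsion cochain `χ` satisfies the eigen-relation `(Tχ)(β) = a·χ(β)` for `β ∈ N`, then `Tχ = aχ` on all of `Γ`. [folklore; the use of RES-INJ in the inert-Hecke
certificate] -/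
theorem eigen_of_eigen_on (N : Set Γ)
    (hinj : ∀ ψ : Γ → A, (∀ a b : Γ, ψ (a * b) = ψ a + ψ b) → (∀ γ, 3 • ψ γ = 0) → (∀ β ∈ N, ψ β = 0) → ∀ γ, ψ γ = 0)
    (χ : Γ → A) (hχ : ∀ a b : Γ, χ (a * b) = χ a + χ b) (h3 : ∀ γ, 3 • χ γ = 0) (a : ℤ)
    (heigN : ∀ β ∈ N, H.op χ β = a • χ β) : ∀ γ, H.op χ γ = a • χ γ := by
  let ψ : Γ → A := fun γ => H.op χ γ - a • χ γ
  have hψ : ∀ x y : Γ, ψ (x * y) = ψ x + ψ y := by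
    intro x y
    simp only [ψ, H.op_mul χ hχ, hχ, smul_add]
    abel
  have hop3 : ∀ γ, 3 • H.op χ γ = 0 := by
    intro γ; rw [op_apply, Finset.smul_sum]; simp only [h3, Finset.sum_const_zero]
  have hψ3 : ∀ γ, 3 • ψ γ = 0 := by
    intro γ
    simp only [ψ, smul_sub, hop3]
    rw [smul_comm (3 : ℕ) a (χ γ), h3, smul_zero, sub_zero]
  have hψN : ∀ β ∈ N, ψ β = 0 := fun β hβ => by simp only [ψ, heigN β hβ, sub_self]
  intro γ
  have := hinj ψ hψ hψ3 hψN γ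
  exact sub_eq_zero.mp this

end HeckeDatum

/-! #### (T7) the Hecke datum of `Γ = X.Gamma` on `Γ∖ι(O(n))` and the period eigen-relation — PROVED (v9.4) -/

section T7

variable {D M : ℕ} {C : Finset ℕ} (X : CartanLevelCurveData D M C)

/-- **the Hecke datum of `Γ` on `Γ∖ι(O(n))`** (representatives `q.out`; stability = the LEAD's `CartanCover.HeckePeriod.exists_perm_mul`). [folklore] -/
noncomputable def gammaHeckeDatum (n : ℕ) [Fintype (Quotient (X.heckeSetoid n))] :
    HeckeDatum X.Gamma (Quotient (X.heckeSetoid n)) :=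
  HeckeDatum.ofStable (fun q => ((q.out : X.heckeSet n) : GL (Fin 2) ℝ))
    (by
      intro q q' g hg h
      have hr : (X.heckeSetoid n) q'.out q.out := ⟨g, hg, h.symm⟩
      have := Quotient.sound hr
      rw [Quotient.out_eq, Quotient.out_eq] at this
      exact this.symm)
    (by
      intro γ q
      obtain ⟨e, δ, hδ, hδeq⟩ := CartanCover.HeckePeriod.exists_perm_mul X n γ.2
      refine ⟨e q, ?_⟩
      have h := hδeq q
      have : ((q.out : X.heckeSet n) : GL (Fin 2) ℝ) * γ * (((e q).out : X.heckeSet n) : GL (Fin 2) ℝ)⁻¹ = δ q := by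
        rw [h, mul_inv_cancel_right]
      rw [this]; exact hδ q)

theorem gammaHeckeDatum_α (n : ℕ) [Fintype (Quotient (X.heckeSetoid n))] (q : Quotient (X.heckeSetoid n)) :
    (gammaHeckeDatum X n).α q = ((q.out : X.heckeSet n) : GL (Fin 2) ℝ) := by
  rw [gammaHeckeDatum, HeckeDatum.ofStable_α]

/-- **(T7) periods of a `T_n`-eigenform are a Hecke eigen-cochain**: if `T_n F = a·F`, the period cochain `γ ↦ ∫_z^{γ z} F` on `Γ` satisfies `T(per) = a · per` for the
Hecke datum `gammaHeckeDatum X n` — the LEAD's Hecke–period identity `period_smul_eq_sum` read through `HeckeDatum.op`. [cite: ShimuraIATAF1971, §8.3 (8.3.2)] -/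
theorem period_op_eq_smul (n : ℕ) [Fintype (Quotient (X.heckeSetoid n))] (F : CuspForm X.Gamma 2) (a : ℂ)
    (hF : X.heckeFun n F = fun τ => a * F τ) (z : ℍ) (γ : X.Gamma) :
    (gammaHeckeDatum X n).op (fun δ : X.Gamma => segmentIntegral F z ((δ : GL (Fin 2) ℝ) • z)) γ
      = a * segmentIntegral F z ((γ : GL (Fin 2) ℝ) • z) := by
  set H := gammaHeckeDatum X n with hH
  rw [HeckeDatum.op_apply]
  have hα : ∀ q, H.α q = ((q.out : X.heckeSet n) : GL (Fin 2) ℝ) := gammaHeckeDatum_α X n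
  have key := CartanCover.HeckePeriod.period_smul_eq_sum X n F a hF (γ := (γ : GL (Fin 2) ℝ)) (H.σ γ)
    (fun q => H.α q * γ * (H.α (H.σ γ q))⁻¹) (fun q => H.mem γ q)
    (fun q => by rw [← hα q, ← hα (H.σ γ q), inv_mul_cancel_right]) z
  rw [key]

end T7


/-! #### (T10) the Hecke datum of the norm-one group `ι(O¹)` of ANY order on `ι(O¹)∖ι(O(n))` — in particular of `ι(O₀'¹) = coverUnits X q` — PROVED (v9.7) -/

section UnitsHecke

variable {B : Type*} [Ring B] [Algebra ℚ B] (ιB : B →ₐ[ℚ] Matrix (Fin 2) (Fin 2) ℝ) {O : Submodule ℤ B} (hO : Brandt.IsOrder B O)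

/-- `ι(O(n))`: the invertible real matrices `ι(x)`, `x ∈ O`, of determinant `n` (as `CartanLevelCurveData.heckeSet`, for an arbitrary order). [folklore] -/
def unitsHeckeSet (n : ℕ) : Set (GL (Fin 2) ℝ) :=
  {g | (∃ x ∈ O, ιB x = (g : Matrix (Fin 2) (Fin 2) ℝ)) ∧ (g : Matrix (Fin 2) (Fin 2) ℝ).det = n}

/-- left `ι(O¹)`-cosets on `ι(O(n))`. [folklore] -/
def unitsHeckeSetoid (n : ℕ) : Setoid (unitsHeckeSet ιB (O := O) n) where
  r a a' := ∃ γ ∈ normOneUnits ιB hO, γ * (a : GL (Fin 2) ℝ) = a'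
  iseqv :=
    { refl := fun a => ⟨1, one_mem _, one_mul _⟩
      symm := fun {a a'} ⟨γ, hγ, h⟩ => ⟨γ⁻¹, inv_mem hγ, by rw [← h, inv_mul_cancel_left]⟩
      trans := fun {a a' a''} ⟨γ, hγ, h⟩ ⟨γ', hγ', h'⟩ =>
        ⟨γ' * γ, mul_mem hγ' hγ, by rw [mul_assoc, h, h']⟩ }

/-- `ι(O(n)) · ι(O¹) ⊆ ι(O(n))`. [folklore] -/
theorem unitsHeckeSet_mul_mem {n : ℕ} {a γ : GL (Fin 2) ℝ} (ha : a ∈ unitsHeckeSet ιB (O := O) n) (hγ : γ ∈ normOneUnits ιB hO) :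
    a * γ ∈ unitsHeckeSet ιB (O := O) n := by
  obtain ⟨⟨x, hx, hxa⟩, hdet⟩ := ha
  obtain ⟨⟨y, hy, hyγ⟩, -, hγ1⟩ := hγ
  refine ⟨⟨x * y, hO.mul_mem x hx y hy, by rw [map_mul, hxa, hyγ, Units.val_mul]⟩, ?_⟩
  rw [Units.val_mul, Matrix.det_mul, hdet, ← Matrix.GeneralLinearGroup.val_det_apply, hγ1, Units.val_one, mul_one]

/-- **right multiplication by `γ ∈ ι(O¹)` permutes `ι(O¹)∖ι(O(n))`** (the LEAD's `CartanCover.HeckePeriod.exists_perm_mul`, for an arbitrary order). [cite: ShimuraIATAF1971, §3.3] -/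
theorem units_exists_perm_mul (n : ℕ) {γ : GL (Fin 2) ℝ} (hγ : γ ∈ normOneUnits ιB hO) :
    ∃ (e : Quotient (unitsHeckeSetoid ιB hO n) ≃ Quotient (unitsHeckeSetoid ιB hO n))
      (δ : Quotient (unitsHeckeSetoid ιB hO n) → GL (Fin 2) ℝ),
      (∀ q, δ q ∈ normOneUnits ιB hO) ∧
      ∀ q, ((q.out : unitsHeckeSet ιB (O := O) n) : GL (Fin 2) ℝ) * γ
        = δ q * (((e q).out : unitsHeckeSet ιB (O := O) n) : GL (Fin 2) ℝ) := by
  let S := unitsHeckeSet ιB (O := O) n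
  let ρ : S → S := fun a => ⟨a * γ, unitsHeckeSet_mul_mem ιB hO a.2 hγ⟩
  let ρ' : S → S := fun a => ⟨a * γ⁻¹, unitsHeckeSet_mul_mem ιB hO a.2 (inv_mem hγ)⟩
  have hρ : ∀ a b : S, (unitsHeckeSetoid ιB hO n) a b → (unitsHeckeSetoid ιB hO n) (ρ a) (ρ b) := by
    rintro a b ⟨δ, hδ, hab⟩
    exact ⟨δ, hδ, by simp only [ρ, ← mul_assoc, hab]⟩
  have hρ' : ∀ a b : S, (unitsHeckeSetoid ιB hO n) a b → (unitsHeckeSetoid ιB hO n) (ρ' a) (ρ' b) := by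
    rintro a b ⟨δ, hδ, hab⟩
    exact ⟨δ, hδ, by simp only [ρ', ← mul_assoc, hab]⟩
  let e : Quotient (unitsHeckeSetoid ιB hO n) ≃ Quotient (unitsHeckeSetoid ιB hO n) :=
    { toFun := Quotient.map ρ hρ
      invFun := Quotient.map ρ' hρ'
      left_inv := fun q => Quotient.inductionOn q fun a => by
        simp only [Quotient.map_mk]
        refine congrArg _ (Subtype.ext ?_)
        simp only [ρ, ρ', mul_inv_cancel_right]
      right_inv := fun q => Quotient.inductionOn q fun a => by
        simp only [Quotient.map_mk]
        refine congrArg _ (Subtype.ext ?_)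
        simp only [ρ, ρ', inv_mul_cancel_right] }
  have hδex : ∀ q : Quotient (unitsHeckeSetoid ιB hO n), ∃ δ ∈ normOneUnits ιB hO,
      ((q.out : S) : GL (Fin 2) ℝ) * γ = δ * (((e q).out : S) : GL (Fin 2) ℝ) := by
    intro q
    have h1 : e q = Quotient.mk _ (ρ q.out) := by
      change Quotient.map ρ hρ q = _
      conv_lhs => rw [← Quotient.out_eq q]
      rfl
    have h2 : (unitsHeckeSetoid ιB hO n) (e q).out (ρ q.out) := Quotient.exact (((e q).out_eq).trans h1)
    obtain ⟨δ, hδ, hδeq⟩ := h2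
    refine ⟨δ, hδ, ?_⟩
    have hδeq' : δ * (((e q).out : S) : GL (Fin 2) ℝ) = ((q.out : S) : GL (Fin 2) ℝ) * γ := hδeq
    exact hδeq'.symm
  choose δ hδ hδeq using hδex
  exact ⟨e, δ, hδ, hδeq⟩

/-- **(T10) the Hecke datum of `ι(O¹)` on `ι(O¹)∖ι(O(n))`** for an arbitrary order `O` (representatives `q.out`), given finiteness of the coset space. [folklore] -/
noncomputable def unitsHeckeDatum (n : ℕ) [Finite (Quotient (unitsHeckeSetoid ιB hO n))] :
    HeckeDatum (normOneUnits ιB hO) (Quotient (unitsHeckeSetoid ιB hO n)) :=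
  HeckeDatum.ofStable (fun q => ((q.out : unitsHeckeSet ιB (O := O) n) : GL (Fin 2) ℝ))
    (by
      intro q q' g hg h
      have hr : (unitsHeckeSetoid ιB hO n) q'.out q.out := ⟨g, hg, h.symm⟩
      have := Quotient.sound hr
      rw [Quotient.out_eq, Quotient.out_eq] at this
      exact this.symm)
    (by
      intro γ q
      obtain ⟨e, δ, hδ, hδeq⟩ := units_exists_perm_mul ιB hO n γ.2
      refine ⟨e q, ?_⟩
      have : ((q.out : unitsHeckeSet ιB (O := O) n) : GL (Fin 2) ℝ) * γ * (((e q).out : unitsHeckeSet ιB (O := O) n) : GL (Fin 2) ℝ)⁻¹ = δ q := by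
        rw [hδeq q, mul_inv_cancel_right]
      rw [this]; exact hδ q)

end UnitsHecke

/-- **the Hecke datum of `ι(O₀'¹) = coverUnits X q` on `ι(O₀'¹)∖ι(O₀'(n))`** — THE object of the inert-Hecke certificate for (OBS) (apply with `n = ℓ` prime, `ℓ ∤ 3 q N`; then
change representatives to a common reduction mod `q` by (T9) + (M0), restrict to `Γ̄(q)` by (T2′)). [folklore] -/
noncomputable def coverHeckeDatum {D M : ℕ} {C : Finset ℕ} (X : CartanLevelCurveData D M C) (q n : ℕ)
    [Finite (Quotient (unitsHeckeSetoid X.ι (CartanCover.isOrder_coverOrder X q) n))] :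
    HeckeDatum (CartanCover.coverUnits X q) (Quotient (unitsHeckeSetoid X.ι (CartanCover.isOrder_coverOrder X q) n)) :=
  unitsHeckeDatum X.ι (CartanCover.isOrder_coverOrder X q) n


/-! ### (T11) ONE FAMILY OF REPRESENTATIVES FOR THE THREE GROUPS `Γ̄(q) ≤ Γ ≤ ι(O₀'¹)`

The inert-Hecke certificate compares THREE Hecke operators at a prime `ℓ ∤ 3qN`: on `Γ = ι(O¹)` (where `per_F` is eigen, (T7)), on the cover group
`U = ι(O₀'¹) = coverUnits X q` (where `χ̄` lives) and on `N = Γ̄(q) = principalLevel X q` (where `χ̄ = c·per_F`). They are compatible as soon as ONE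
family of representatives `α_i ∈ ι(O(ℓ))` serves all three: `U`-inequivalent and `U`-stable (then `ofStable` gives the `U`-datum, whose permutations and
operator agree with the `Γ`-datum on `Γ`, (T11a)), and mapping `N` to `N` (then the eigen-relation transfers from `Γ` to `U` along `N`, (T11b)). The
existence of such a family — `Γ`-translates `g_i · q_i.out` of the tree's representatives with a COMMON reduction mod `q` — is the print input (SIMREP)
below (strong approximation, (M0), and the local structure at `ℓ`). -/

section Overgroup

namespace HeckeDatum

variable {𝔾 : Type*} [Group 𝔾] {Γ : Subgroup 𝔾} {ι : Type*} [Fintype ι] (H : HeckeDatum Γ ι)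

/-- **(T11a) overgroup on the same representatives — permutations agree on `Γ`.** [folklore] -/
theorem σ_ofStable_overgroup (U : Subgroup 𝔾) (hΓU : Γ ≤ U)
    (disjU : ∀ (i j : ι) (g : 𝔾), g ∈ U → H.α i = g * H.α j → i = j)
    (stabU : ∀ (u : U) (i : ι), ∃ j, H.α i * u * (H.α j)⁻¹ ∈ U) (γ : Γ) (i : ι) :
    (ofStable (Γ := U) H.α disjU stabU).σ ⟨γ, hΓU γ.2⟩ i = H.σ γ i := by
  symm
  apply (ofStable (Γ := U) H.α disjU stabU).σ_unique ⟨γ, hΓU γ.2⟩ i (H.σ γ i)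
  simp only [ofStable_α]
  exact hΓU (H.mem γ i)

/-- **(T11a) overgroup on the same representatives — the operator restricted to `Γ` is the `Γ`-operator of the restricted cochain**:
`(T_U χ)(γ) = (T_Γ (χ|Γ))(γ)` for `γ ∈ Γ`. [folklore] -/
theorem op_ofStable_overgroup {A : Type*} [AddCommGroup A] (U : Subgroup 𝔾) (hΓU : Γ ≤ U)
    (disjU : ∀ (i j : ι) (g : 𝔾), g ∈ U → H.α i = g * H.α j → i = j)
    (stabU : ∀ (u : U) (i : ι), ∃ j, H.α i * u * (H.α j)⁻¹ ∈ U) (χ : U → A) (γ : Γ) :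
    (ofStable (Γ := U) H.α disjU stabU).op χ ⟨γ, hΓU γ.2⟩ = H.op (fun δ : Γ => χ ⟨δ, hΓU δ.2⟩) γ := by
  rw [op_apply, op_apply]
  refine Finset.sum_congr rfl fun i _ => ?_
  have e : (⟨(ofStable (Γ := U) H.α disjU stabU).α i * ((⟨(γ : 𝔾), hΓU γ.2⟩ : U) : 𝔾)
        * ((ofStable (Γ := U) H.α disjU stabU).α ((ofStable (Γ := U) H.α disjU stabU).σ ⟨γ, hΓU γ.2⟩ i))⁻¹,
        (ofStable (Γ := U) H.α disjU stabU).mem ⟨γ, hΓU γ.2⟩ i⟩ : U)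
      = ⟨H.α i * γ * (H.α (H.σ γ i))⁻¹, hΓU (H.mem γ i)⟩ := by
    apply Subtype.ext
    simp only [ofStable_α, H.σ_ofStable_overgroup U hΓU disjU stabU γ i]
  rw [e]

/-- **(T11b) EIGEN-TRANSFER ALONG A SUBGROUP SERVED BY THE SAME REPRESENTATIVES.** `N ≤ Γ ≤ U`; the representatives of `H` send `N` to `N`
(`memN`); `χ : U → A` agrees on `N` with `ψ : Γ → A`; and `ψ` satisfies `(T_Γ ψ)(β) = f(ψ(β))` at the elements of `N` (`f` = multiplication by the
eigenvalue). Then `(T_U χ)(β) = f(χ(β))` for every `β ∈ N`. In the certificate: `U = ι(O₀'¹)`, `Γ = ι(O¹)`, `N = Γ̄(q)`, `ψ = c·per_F` (eigen by (T7)+(T8)),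
`χ` the extension of (OBS); with RES-INJ ((T5), `modThree_trivial_of_trivial_on_principalLevel`) the relation then holds on all of `U`. [folklore] -/
theorem op_ofStable_overgroup_eq_on {A : Type*} [AddCommGroup A] (U : Subgroup 𝔾) (hΓU : Γ ≤ U)
    (disjU : ∀ (i j : ι) (g : 𝔾), g ∈ U → H.α i = g * H.α j → i = j)
    (stabU : ∀ (u : U) (i : ι), ∃ j, H.α i * u * (H.α j)⁻¹ ∈ U)
    (N : Subgroup 𝔾) (hNΓ : N ≤ Γ)
    (memN : ∀ (β : 𝔾) (hβ : β ∈ N) (i : ι), H.α i * β * (H.α (H.σ ⟨β, hNΓ hβ⟩ i))⁻¹ ∈ N)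
    (χ : U → A) (ψ : Γ → A) (hagree : ∀ (n : 𝔾) (hn : n ∈ N), χ ⟨n, hΓU (hNΓ hn)⟩ = ψ ⟨n, hNΓ hn⟩)
    (f : A → A) (heig : ∀ (β : 𝔾) (hβ : β ∈ N), H.op ψ ⟨β, hNΓ hβ⟩ = f (ψ ⟨β, hNΓ hβ⟩))
    (β : 𝔾) (hβ : β ∈ N) :
    (ofStable (Γ := U) H.α disjU stabU).op χ ⟨β, hΓU (hNΓ hβ)⟩ = f (χ ⟨β, hΓU (hNΓ hβ)⟩) := by
  have e1 := H.op_ofStable_overgroup U hΓU disjU stabU χ ⟨β, hNΓ hβ⟩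
  have e2 : (⟨β, hΓU (hNΓ hβ)⟩ : U) = ⟨((⟨β, hNΓ hβ⟩ : Γ) : 𝔾), hΓU (⟨β, hNΓ hβ⟩ : Γ).2⟩ := rfl
  rw [e2, e1, hagree β hβ, ← heig β hβ, op_apply, op_apply]
  refine Finset.sum_congr rfl fun i _ => ?_
  exact hagree _ (memN β hβ i)

omit [Fintype ι] in
/-- **(T11b′) the `memN` criterion from a two-sided test**: if every `α_i β α_j⁻¹` (`β ∈ N`) that lies in `Γ` already lies in `N`, the representatives
serve `N`. (With a reduction map: all `α_i` have a common reduction mod `q` and `N = ker`, (T2′) `memN_of_reduction`.) [folklore] -/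
theorem memN_of_criterion (N : Subgroup 𝔾) (hNΓ : N ≤ Γ)
    (crit : ∀ (β : 𝔾), β ∈ N → ∀ (i j : ι), H.α i * β * (H.α j)⁻¹ ∈ Γ → H.α i * β * (H.α j)⁻¹ ∈ N)
    (β : 𝔾) (hβ : β ∈ N) (i : ι) : H.α i * β * (H.α (H.σ ⟨β, hNΓ hβ⟩ i))⁻¹ ∈ N :=
  crit β hβ i _ (H.mem ⟨β, hNΓ hβ⟩ i)

end HeckeDatum

end Overgroup

section T11c

variable {D M : ℕ} {C : Finset ℕ} (X : CartanLevelCurveData D M C)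

/-- **(T11c) the period cochain stays eigen after a change of representatives** (`(T7)` + `(T8)` + additivity of periods `period_mul'`). [cite: ShimuraIATAF1971, §8.3 (8.3.2)] -/
theorem period_op_changeReps_eq_smul (n : ℕ) [Fintype (Quotient (X.heckeSetoid n))] (F : CuspForm X.Gamma 2) (a : ℂ)
    (hF : X.heckeFun n F = fun τ => a * F τ) (z : ℍ) (g : Quotient (X.heckeSetoid n) → X.Gamma) (γ : X.Gamma) :
    ((gammaHeckeDatum X n).changeReps g).op (fun δ : X.Gamma => segmentIntegral F z ((δ : GL (Fin 2) ℝ) • z)) γ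
      = a * segmentIntegral F z ((γ : GL (Fin 2) ℝ) • z) := by
  rw [HeckeDatum.op_changeReps _ g _ (fun δ₁ δ₂ => by
    simpa only [Subgroup.coe_mul] using period_mul' F δ₁.2 (δ₂ : GL (Fin 2) ℝ) z)]
  exact period_op_eq_smul X n F a hF z γ

/-- **(T11d) THE COVER-LEVEL EIGEN-RELATION ON `Γ̄(q)`** — (T11a–c) assembled for `U = coverUnits X q`, `Γ = X.Gamma`, `N = principalLevel X q`: if the changed
representatives `g_i · q_i.out` are `U`-inequivalent, `U`-stable and pass the two-sided test for `Γ̄(q)`, then for ANY cochain `χ` on `U` agreeing on `Γ̄(q)` with a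
cochain `ψ` on `Γ` that is eigen for the changed `Γ`-datum (e.g. `ψ = c·per_F` pushed to `Λ∕3Λ`, by (T11c)), the `U`-operator satisfies the same relation on `Γ̄(q)`. [folklore] -/
theorem cover_op_eq_on_principalLevel {q : ℕ} (hq : q ∈ C) (n : ℕ) [Fintype (Quotient (X.heckeSetoid n))]
    (g : Quotient (X.heckeSetoid n) → X.Gamma)
    (disjU : ∀ (i j : Quotient (X.heckeSetoid n)) (u : GL (Fin 2) ℝ), u ∈ CartanCover.coverUnits X q →
      ((gammaHeckeDatum X n).changeReps g).α i = u * ((gammaHeckeDatum X n).changeReps g).α j → i = j)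
    (stabU : ∀ (u : CartanCover.coverUnits X q) (i : Quotient (X.heckeSetoid n)), ∃ j,
      ((gammaHeckeDatum X n).changeReps g).α i * u * (((gammaHeckeDatum X n).changeReps g).α j)⁻¹ ∈ CartanCover.coverUnits X q)
    (crit : ∀ (β : GL (Fin 2) ℝ), β ∈ CartanCover.principalLevel X q → ∀ (i j : Quotient (X.heckeSetoid n)),
      ((gammaHeckeDatum X n).changeReps g).α i * β * (((gammaHeckeDatum X n).changeReps g).α j)⁻¹ ∈ X.Gamma →
      ((gammaHeckeDatum X n).changeReps g).α i * β * (((gammaHeckeDatum X n).changeReps g).α j)⁻¹ ∈ CartanCover.principalLevel X q)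
    {A : Type*} [AddCommGroup A] (χ : CartanCover.coverUnits X q → A) (ψ : X.Gamma → A)
    (hagree : ∀ (β : GL (Fin 2) ℝ) (hβ : β ∈ CartanCover.principalLevel X q),
      χ ⟨β, CartanCover.principalLevel_le_coverUnits X q hβ⟩ = ψ ⟨β, CartanCover.principalLevel_le_Gamma X q hq hβ⟩)
    (f : A → A) (heig : ∀ γ : X.Gamma, ((gammaHeckeDatum X n).changeReps g).op ψ γ = f (ψ γ))
    (β : GL (Fin 2) ℝ) (hβ : β ∈ CartanCover.principalLevel X q) :
    (HeckeDatum.ofStable (Γ := CartanCover.coverUnits X q) ((gammaHeckeDatum X n).changeReps g).α disjU stabU).op χ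
        ⟨β, CartanCover.principalLevel_le_coverUnits X q hβ⟩
      = f (χ ⟨β, CartanCover.principalLevel_le_coverUnits X q hβ⟩) :=
  ((gammaHeckeDatum X n).changeReps g).op_ofStable_overgroup_eq_on (CartanCover.coverUnits X q) (CartanCover.Gamma_le_coverUnits X q)
    disjU stabU (CartanCover.principalLevel X q) (CartanCover.principalLevel_le_Gamma X q hq)
    (((gammaHeckeDatum X n).changeReps g).memN_of_criterion _ _ crit) χ ψ hagree f (fun b _hb => heig ⟨b, _⟩) β hβ

/-- **(T12) THE COVER-LEVEL EIGEN-RELATION ON ALL OF `ι(O₀'¹)`** — (T11d) + RES-INJ (`modThree_trivial_of_trivial_on_principalLevel`, from (M0)) + (T5): a mod-`3` additive cochain `χ` on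
`U = coverUnits X q` (`3χ = 0`) that agrees on `Γ̄(q)` with an eigen-cochain `ψ` of the (changed) `Γ`-datum (`T ψ = a•ψ`) is itself eigen for the cover operator: `T_U χ = a•χ` on `U`.
With `ψ = c·per_F mod 3Λ` ((T11c), eigenvalue `a = a_ℓ(W₁) = a_ℓ(V)`) this is the relation the certificate feeds into (T3)∕(T4). Inputs left: the representatives (SIMREP), `R`, and `q ≠ 3` (crux
hypothesis). [folklore] -/
theorem cover_op_eq_smul_of_agree {q : ℕ} [Fact q.Prime] (hq : q ∈ C) (hq3 : q ≠ 3) (R : CartanCover.CoverReduction X q)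
    (hM0 : CartanCover.Charext.StrongApproxAtCartanPlace) (n : ℕ) [Fintype (Quotient (X.heckeSetoid n))]
    (g : Quotient (X.heckeSetoid n) → X.Gamma)
    (disjU : ∀ (i j : Quotient (X.heckeSetoid n)) (u : GL (Fin 2) ℝ), u ∈ CartanCover.coverUnits X q →
      ((gammaHeckeDatum X n).changeReps g).α i = u * ((gammaHeckeDatum X n).changeReps g).α j → i = j)
    (stabU : ∀ (u : CartanCover.coverUnits X q) (i : Quotient (X.heckeSetoid n)), ∃ j,
      ((gammaHeckeDatum X n).changeReps g).α i * u * (((gammaHeckeDatum X n).changeReps g).α j)⁻¹ ∈ CartanCover.coverUnits X q)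
    (crit : ∀ (β : GL (Fin 2) ℝ), β ∈ CartanCover.principalLevel X q → ∀ (i j : Quotient (X.heckeSetoid n)),
      ((gammaHeckeDatum X n).changeReps g).α i * β * (((gammaHeckeDatum X n).changeReps g).α j)⁻¹ ∈ X.Gamma →
      ((gammaHeckeDatum X n).changeReps g).α i * β * (((gammaHeckeDatum X n).changeReps g).α j)⁻¹ ∈ CartanCover.principalLevel X q)
    {A : Type*} [AddCommGroup A] (χ : CartanCover.coverUnits X q → A) (hχ : ∀ a b, χ (a * b) = χ a + χ b) (h3 : ∀ γ, 3 • χ γ = 0)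
    (ψ : X.Gamma → A)
    (hagree : ∀ (β : GL (Fin 2) ℝ) (hβ : β ∈ CartanCover.principalLevel X q),
      χ ⟨β, CartanCover.principalLevel_le_coverUnits X q hβ⟩ = ψ ⟨β, CartanCover.principalLevel_le_Gamma X q hq hβ⟩)
    (a : ℤ) (heig : ∀ γ : X.Gamma, ((gammaHeckeDatum X n).changeReps g).op ψ γ = a • ψ γ) :
    ∀ u : CartanCover.coverUnits X q,
      (HeckeDatum.ofStable (Γ := CartanCover.coverUnits X q) ((gammaHeckeDatum X n).changeReps g).α disjU stabU).op χ u = a • χ u := by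
  refine (HeckeDatum.ofStable (Γ := CartanCover.coverUnits X q) ((gammaHeckeDatum X n).changeReps g).α disjU stabU).eigen_of_eigen_on
    {γ : CartanCover.coverUnits X q | (γ : GL (Fin 2) ℝ) ∈ CartanCover.principalLevel X q}
    (fun ψ' hψ' h3' hker => modThree_trivial_of_trivial_on_principalLevel
      (fun D' M' C' X' q' _ hq' R' g' hg' => hM0 D' M' C' X' q' hq' R' g' hg') X q hq hq3 R ψ' hψ' h3' (fun γ hγ => hker γ hγ))
    χ hχ h3 a ?_
  intro β hβ
  have h := cover_op_eq_on_principalLevel X hq n g disjU stabU crit χ ψ hagree (fun x => a • x) heig (β : GL (Fin 2) ℝ) hβ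
  simpa only [Subtype.coe_eta] using h

/-- **(T13) THE PUNCHLINE OF THE CERTIFICATE, TYPED: `χ̄` KILLS EVERY ELEMENT OF THE COVER GROUP WHOSE CUBE IS CENTRAL AND WHOSE COSET PERMUTATION IS FIXED-POINT-FREE.**
(T12) + (T3)∕(T4): under the hypotheses of (T12) with `3 ∤ a`, every `x ∈ ι(O₀'¹)` with `x³ = c` central (the elliptic elements of order `3` and `6`: `c = ±1`) and `σ_x` without fixed
points on the `ℓ + 1` cosets (by (T6): `ℓ ≡ 2 (mod 3)` and the cosets are `ℙ¹(𝔽_ℓ)`) satisfies `χ̄(x) = 0`; `χ̄(c) = χ̄(x³) = 3χ̄(x) = 0` is automatic. What is left to the OBS prover: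
SIMREP (the representatives), the `ℙ¹(𝔽_ℓ)`-identification feeding (T6), a prime `ℓ ≡ 2 (3)` with `3 ∤ a_ℓ(V)` (Chebotarev for `Surj V 3`), and the automorphic cites turning
«eigen, additive mod 3, null on all torsion» into a weight-2 level-prime-to-`q` congruence (torsion-free lift ∕ DS 6.11 ∕ ES–MS ∕ JL — or CAR, `CartanCarayol.noModThreePeriodCharacterExtension_of_carayol`). [folklore] -/
theorem cover_apply_eq_zero_of_cube_central {q : ℕ} [Fact q.Prime] (hq : q ∈ C) (hq3 : q ≠ 3) (R : CartanCover.CoverReduction X q)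
    (hM0 : CartanCover.Charext.StrongApproxAtCartanPlace) (n : ℕ) [Fintype (Quotient (X.heckeSetoid n))]
    (g : Quotient (X.heckeSetoid n) → X.Gamma)
    (disjU : ∀ (i j : Quotient (X.heckeSetoid n)) (u : GL (Fin 2) ℝ), u ∈ CartanCover.coverUnits X q →
      ((gammaHeckeDatum X n).changeReps g).α i = u * ((gammaHeckeDatum X n).changeReps g).α j → i = j)
    (stabU : ∀ (u : CartanCover.coverUnits X q) (i : Quotient (X.heckeSetoid n)), ∃ j,
      ((gammaHeckeDatum X n).changeReps g).α i * u * (((gammaHeckeDatum X n).changeReps g).α j)⁻¹ ∈ CartanCover.coverUnits X q)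
    (crit : ∀ (β : GL (Fin 2) ℝ), β ∈ CartanCover.principalLevel X q → ∀ (i j : Quotient (X.heckeSetoid n)),
      ((gammaHeckeDatum X n).changeReps g).α i * β * (((gammaHeckeDatum X n).changeReps g).α j)⁻¹ ∈ X.Gamma →
      ((gammaHeckeDatum X n).changeReps g).α i * β * (((gammaHeckeDatum X n).changeReps g).α j)⁻¹ ∈ CartanCover.principalLevel X q)
    {A : Type*} [AddCommGroup A] (χ : CartanCover.coverUnits X q → A) (hχ : ∀ a b, χ (a * b) = χ a + χ b) (h3 : ∀ γ, 3 • χ γ = 0)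
    (ψ : X.Gamma → A)
    (hagree : ∀ (β : GL (Fin 2) ℝ) (hβ : β ∈ CartanCover.principalLevel X q),
      χ ⟨β, CartanCover.principalLevel_le_coverUnits X q hβ⟩ = ψ ⟨β, CartanCover.principalLevel_le_Gamma X q hq hβ⟩)
    (a : ℤ) (ha : ¬ (3 : ℤ) ∣ a) (heig : ∀ γ : X.Gamma, ((gammaHeckeDatum X n).changeReps g).op ψ γ = a • ψ γ)
    (x c : CartanCover.coverUnits X q) (hx : x ^ 3 = c) (hc : ∀ g' : GL (Fin 2) ℝ, g' * c = c * g')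
    (hfix : ∀ i, (HeckeDatum.ofStable (Γ := CartanCover.coverUnits X q) ((gammaHeckeDatum X n).changeReps g).α disjU stabU).σ x i ≠ i) :
    χ x = 0 := by
  classical
  have hχc : χ c = 0 := by
    rw [← hx, pow_succ, pow_two, hχ, hχ]
    have e : χ x + χ x + χ x = 3 • χ x := by
      rw [show (3 : ℕ) = 2 + 1 from rfl, add_nsmul, two_nsmul, one_nsmul]
    rw [e]; exact h3 x
  exact (HeckeDatum.ofStable (Γ := CartanCover.coverUnits X q) ((gammaHeckeDatum X n).changeReps g).α disjU stabU).apply_eq_zero_of_eigen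
    χ hχ h3 a ha (cover_op_eq_smul_of_agree X hq hq3 R hM0 n g disjU stabU crit χ hχ h3 ψ hagree a heig) x c hx hc hχc hfix

/-! #### The `Γ̄(q)`-level variants (the comparison cochain `ψ` lives only on `Γ̄(q)`)

In (OBS) the comparison cochain `c·per_F` is `Λ`-valued only on `Γ̄(q)` (elsewhere `c·per_F(γ)` need not lie in `Λ`), so its mod-`3Λ` class `ψ̄` is a cochain on `N = Γ̄(q)`,
not on `Γ`. The restricted datum `H_N = (changed Γ-datum).restrict N` (T2′, same representatives) carries it: `per_F` is `H_N`-eigen on `N` in `ℂ` ((T11c) through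
`op_restrict`), hence `ψ̄` is `H_N`-eigen in `Λ∕3Λ`, and (T12)∕(T13) run with `Γ := N`. -/

/-- **(T11c′) the period cochain is eigen for the `Γ̄(q)`-RESTRICTED datum** (values in `ℂ`; (T11c) read through (T2′) `op_restrict`). [cite: ShimuraIATAF1971, §8.3 (8.3.2)] -/
theorem period_op_restrict_eq_smul {q : ℕ} (hq : q ∈ C) (n : ℕ) [Fintype (Quotient (X.heckeSetoid n))] (F : CuspForm X.Gamma 2) (a : ℂ)
    (hF : X.heckeFun n F = fun τ => a * F τ) (z : ℍ) (g : Quotient (X.heckeSetoid n) → X.Gamma)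
    (memN : ∀ (β : CartanCover.principalLevel X q) (i : Quotient (X.heckeSetoid n)),
      ((gammaHeckeDatum X n).changeReps g).α i * β *
        (((gammaHeckeDatum X n).changeReps g).α (((gammaHeckeDatum X n).changeReps g).σ ⟨β, CartanCover.principalLevel_le_Gamma X q hq β.2⟩ i))⁻¹ ∈
        CartanCover.principalLevel X q)
    (β : CartanCover.principalLevel X q) :
    (((gammaHeckeDatum X n).changeReps g).restrict (CartanCover.principalLevel X q) (CartanCover.principalLevel_le_Gamma X q hq) memN).op
        (fun δ : CartanCover.principalLevel X q => segmentIntegral F z ((δ : GL (Fin 2) ℝ) • z)) β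
      = a * segmentIntegral F z ((β : GL (Fin 2) ℝ) • z) := by
  have h := period_op_changeReps_eq_smul X n F a hF z g ⟨β, CartanCover.principalLevel_le_Gamma X q hq β.2⟩
  rw [HeckeDatum.op_restrict _ (CartanCover.principalLevel X q) (CartanCover.principalLevel_le_Gamma X q hq) memN] at h
  exact h

/-- **(T12′) cover-level eigen-relation from a comparison cochain on `Γ̄(q)` only**: as (T12), with `ψ : Γ̄(q) → A` eigen for the RESTRICTED datum. [folklore] -/
theorem cover_op_eq_smul_of_agree_on {q : ℕ} [Fact q.Prime] (hq : q ∈ C) (hq3 : q ≠ 3) (R : CartanCover.CoverReduction X q)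
    (hM0 : CartanCover.Charext.StrongApproxAtCartanPlace) (n : ℕ) [Fintype (Quotient (X.heckeSetoid n))]
    (g : Quotient (X.heckeSetoid n) → X.Gamma)
    (disjU : ∀ (i j : Quotient (X.heckeSetoid n)) (u : GL (Fin 2) ℝ), u ∈ CartanCover.coverUnits X q →
      ((gammaHeckeDatum X n).changeReps g).α i = u * ((gammaHeckeDatum X n).changeReps g).α j → i = j)
    (stabU : ∀ (u : CartanCover.coverUnits X q) (i : Quotient (X.heckeSetoid n)), ∃ j,
      ((gammaHeckeDatum X n).changeReps g).α i * u * (((gammaHeckeDatum X n).changeReps g).α j)⁻¹ ∈ CartanCover.coverUnits X q)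
    (memN : ∀ (β : CartanCover.principalLevel X q) (i : Quotient (X.heckeSetoid n)),
      ((gammaHeckeDatum X n).changeReps g).α i * β *
        (((gammaHeckeDatum X n).changeReps g).α (((gammaHeckeDatum X n).changeReps g).σ ⟨β, CartanCover.principalLevel_le_Gamma X q hq β.2⟩ i))⁻¹ ∈
        CartanCover.principalLevel X q)
    {A : Type*} [AddCommGroup A] (χ : CartanCover.coverUnits X q → A) (hχ : ∀ a b, χ (a * b) = χ a + χ b) (h3 : ∀ γ, 3 • χ γ = 0)
    (ψ : CartanCover.principalLevel X q → A)
    (hagree : ∀ (β : GL (Fin 2) ℝ) (hβ : β ∈ CartanCover.principalLevel X q),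
      χ ⟨β, CartanCover.principalLevel_le_coverUnits X q hβ⟩ = ψ ⟨β, hβ⟩)
    (a : ℤ) (heig : ∀ β : CartanCover.principalLevel X q,
      (((gammaHeckeDatum X n).changeReps g).restrict (CartanCover.principalLevel X q) (CartanCover.principalLevel_le_Gamma X q hq) memN).op ψ β
        = a • ψ β) :
    ∀ u : CartanCover.coverUnits X q,
      (HeckeDatum.ofStable (Γ := CartanCover.coverUnits X q) ((gammaHeckeDatum X n).changeReps g).α disjU stabU).op χ u = a • χ u := by
  -- the restricted datum has the same representatives; run (T11b) with `Γ := Γ̄(q)`, `N := Γ̄(q)`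
  set HN := ((gammaHeckeDatum X n).changeReps g).restrict (CartanCover.principalLevel X q) (CartanCover.principalLevel_le_Gamma X q hq) memN
    with hHN
  have hαN : HN.α = ((gammaHeckeDatum X n).changeReps g).α := rfl
  refine (HeckeDatum.ofStable (Γ := CartanCover.coverUnits X q) ((gammaHeckeDatum X n).changeReps g).α disjU stabU).eigen_of_eigen_on
    {γ : CartanCover.coverUnits X q | (γ : GL (Fin 2) ℝ) ∈ CartanCover.principalLevel X q}
    (fun ψ' hψ' h3' hker => modThree_trivial_of_trivial_on_principalLevel
      (fun D' M' C' X' q' _ hq' R' g' hg' => hM0 D' M' C' X' q' hq' R' g' hg') X q hq hq3 R ψ' hψ' h3' (fun γ hγ => hker γ hγ))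
    χ hχ h3 a ?_
  intro β hβ
  have h : (HeckeDatum.ofStable (Γ := CartanCover.coverUnits X q) ((gammaHeckeDatum X n).changeReps g).α disjU stabU).op χ
        ⟨(β : GL (Fin 2) ℝ), CartanCover.principalLevel_le_coverUnits X q hβ⟩
      = a • χ ⟨(β : GL (Fin 2) ℝ), CartanCover.principalLevel_le_coverUnits X q hβ⟩ :=
    HN.op_ofStable_overgroup_eq_on (CartanCover.coverUnits X q) (CartanCover.principalLevel_le_coverUnits X q)
      disjU stabU (CartanCover.principalLevel X q) le_rfl (fun b hb i => HN.mem ⟨b, hb⟩ i) χ ψ (fun b hb => hagree b hb)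
      (fun x => a • x) (fun b hb => heig ⟨b, hb⟩) (β : GL (Fin 2) ℝ) hβ
  simpa only [Subtype.coe_eta] using h

/-- **(T13′) the punchline from a comparison cochain on `Γ̄(q)` only**: as (T13), with `ψ : Γ̄(q) → A` eigen for the restricted datum and `3 ∤ a`. [folklore] -/
theorem cover_apply_eq_zero_of_cube_central_on {q : ℕ} [Fact q.Prime] (hq : q ∈ C) (hq3 : q ≠ 3) (R : CartanCover.CoverReduction X q)
    (hM0 : CartanCover.Charext.StrongApproxAtCartanPlace) (n : ℕ) [Fintype (Quotient (X.heckeSetoid n))]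
    (g : Quotient (X.heckeSetoid n) → X.Gamma)
    (disjU : ∀ (i j : Quotient (X.heckeSetoid n)) (u : GL (Fin 2) ℝ), u ∈ CartanCover.coverUnits X q →
      ((gammaHeckeDatum X n).changeReps g).α i = u * ((gammaHeckeDatum X n).changeReps g).α j → i = j)
    (stabU : ∀ (u : CartanCover.coverUnits X q) (i : Quotient (X.heckeSetoid n)), ∃ j,
      ((gammaHeckeDatum X n).changeReps g).α i * u * (((gammaHeckeDatum X n).changeReps g).α j)⁻¹ ∈ CartanCover.coverUnits X q)
    (memN : ∀ (β : CartanCover.principalLevel X q) (i : Quotient (X.heckeSetoid n)),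
      ((gammaHeckeDatum X n).changeReps g).α i * β *
        (((gammaHeckeDatum X n).changeReps g).α (((gammaHeckeDatum X n).changeReps g).σ ⟨β, CartanCover.principalLevel_le_Gamma X q hq β.2⟩ i))⁻¹ ∈
        CartanCover.principalLevel X q)
    {A : Type*} [AddCommGroup A] (χ : CartanCover.coverUnits X q → A) (hχ : ∀ a b, χ (a * b) = χ a + χ b) (h3 : ∀ γ, 3 • χ γ = 0)
    (ψ : CartanCover.principalLevel X q → A)
    (hagree : ∀ (β : GL (Fin 2) ℝ) (hβ : β ∈ CartanCover.principalLevel X q),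
      χ ⟨β, CartanCover.principalLevel_le_coverUnits X q hβ⟩ = ψ ⟨β, hβ⟩)
    (a : ℤ) (ha : ¬ (3 : ℤ) ∣ a) (heig : ∀ β : CartanCover.principalLevel X q,
      (((gammaHeckeDatum X n).changeReps g).restrict (CartanCover.principalLevel X q) (CartanCover.principalLevel_le_Gamma X q hq) memN).op ψ β
        = a • ψ β)
    (x c : CartanCover.coverUnits X q) (hx : x ^ 3 = c) (hc : ∀ g' : GL (Fin 2) ℝ, g' * c = c * g')
    (hfix : ∀ i, (HeckeDatum.ofStable (Γ := CartanCover.coverUnits X q) ((gammaHeckeDatum X n).changeReps g).α disjU stabU).σ x i ≠ i) :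
    χ x = 0 := by
  classical
  have hχc : χ c = 0 := by
    rw [← hx, pow_succ, pow_two, hχ, hχ]
    have e : χ x + χ x + χ x = 3 • χ x := by
      rw [show (3 : ℕ) = 2 + 1 from rfl, add_nsmul, two_nsmul, one_nsmul]
    rw [e]; exact h3 x
  exact (HeckeDatum.ofStable (Γ := CartanCover.coverUnits X q) ((gammaHeckeDatum X n).changeReps g).α disjU stabU).apply_eq_zero_of_eigen
    χ hχ h3 a ha (cover_op_eq_smul_of_agree_on X hq hq3 R hM0 n g disjU stabU memN χ hχ h3 ψ hagree a heig) x c hx hc hχc hfix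

/-! #### (T14) The mod-`3Λ` plumbing: from the hypotheses of (OBS) to cochains with values in `ℂ ∕ 3Λ`

(OBS) speaks of a function `χ : GL₂(ℝ) → ℂ` with values in `Λ = Λ(W₁)` on `ι(O₀'¹)`, additive modulo `3Λ`, congruent to `c·per_F` modulo `3Λ` on `Γ̄(q)`. Reducing modulo the
subgroup `3Λ ⊆ ℂ` gives honest cochains `χ̄`, `ψ̄` with values in the `ℤ`-module `ℂ ∕ 3Λ`: `χ̄` additive with `3χ̄ = 0` (its values come from `Λ`), `ψ̄ = χ̄` on `Γ̄(q)`, and a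
`ℂ`-eigen-relation `T φ = m·φ` (`m ∈ ℤ`, e.g. `m = a_ℓ`) for a cochain `φ` descends to `T φ̄ = m • φ̄`. These are the inputs of (T12′)∕(T13′). -/

section ModThree

variable (Λ : Submodule ℤ ℂ)

/-- `3Λ ⊆ ℂ` as a `ℤ`-submodule. -/
def threeMul : Submodule ℤ ℂ := Λ.map (LinearMap.lsmul ℤ ℂ 3)

theorem mem_threeMul_iff {x : ℂ} : x ∈ threeMul Λ ↔ ∃ y ∈ Λ, 3 * y = x := by
  simp only [threeMul, Submodule.mem_map, LinearMap.lsmul_apply, zsmul_eq_mul, Int.cast_ofNat]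

/-- the reduction `ℂ → ℂ ∕ 3Λ` (the `ℤ`-linear quotient map). -/
def redThree := (threeMul Λ).mkQ

theorem redThree_apply (x : ℂ) : redThree Λ x = Submodule.Quotient.mk x := rfl

theorem redThree_eq_iff {x y : ℂ} : redThree Λ x = redThree Λ y ↔ ∃ z ∈ Λ, x - y = 3 * z := by
  rw [redThree_apply, redThree_apply, Submodule.Quotient.eq, mem_threeMul_iff]
  constructor <;> rintro ⟨z, hz, h⟩ <;> exact ⟨z, hz, h.symm⟩

theorem redThree_eq_zero_of_mem {x : ℂ} (hx : x ∈ threeMul Λ) : redThree Λ x = 0 := by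
  rw [redThree_apply, Submodule.Quotient.mk_eq_zero]; exact hx

/-- values from `Λ` are `3`-torsion modulo `3Λ`. -/
theorem three_nsmul_redThree {x : ℂ} (hx : x ∈ Λ) : 3 • redThree Λ x = 0 := by
  rw [← map_nsmul]
  apply redThree_eq_zero_of_mem
  rw [mem_threeMul_iff]
  exact ⟨x, hx, by rw [nsmul_eq_mul, Nat.cast_ofNat]⟩

/-- **(T14a) the reduced cochain `χ̄ = χ mod 3Λ` on a subgroup `U`**: additive and `3`-torsion, from the (OBS)-shaped hypotheses «values in `Λ`» and «additive modulo `3Λ`». [folklore] -/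
theorem redThree_cochain (U : Subgroup (GL (Fin 2) ℝ)) (χ : GL (Fin 2) ℝ → ℂ) (hΛ : ∀ u ∈ U, χ u ∈ Λ)
    (hadd : ∀ u ∈ U, ∀ v ∈ U, ∃ y ∈ Λ, χ (u * v) - χ u - χ v = 3 * y) :
    (∀ a b : U, redThree Λ (χ ((a * b : U) : GL (Fin 2) ℝ)) = redThree Λ (χ a) + redThree Λ (χ b)) ∧
      (∀ a : U, 3 • redThree Λ (χ a) = 0) := by
  refine ⟨fun a b => ?_, fun a => three_nsmul_redThree Λ (hΛ a a.2)⟩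
  rw [← map_add, redThree_eq_iff]
  obtain ⟨y, hy, h⟩ := hadd a a.2 b b.2
  exact ⟨y, hy, by rw [Subgroup.coe_mul]; linear_combination h⟩

/-- **(T14b) congruent values reduce to the same class** («`χ ≡ c·per_F (mod 3Λ)` on `Γ̄(q)» ⇒ `χ̄ = ψ̄` there). [folklore] -/
theorem redThree_eq_of_congr {x y : ℂ} (h : ∃ z ∈ Λ, x - y = 3 * z) : redThree Λ x = redThree Λ y :=
  (redThree_eq_iff Λ).mpr h

/-- a value congruent modulo `3Λ` to a value in `Λ` lies in `Λ` (so `c·per_F(β) ∈ Λ` for `β ∈ Γ̄(q)` under the hypotheses of (OBS)). [folklore] -/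
theorem mem_of_congr {x y : ℂ} (hx : x ∈ Λ) (h : ∃ z ∈ Λ, x - y = 3 * z) : y ∈ Λ := by
  obtain ⟨z, hz, e⟩ := h
  have : y = x - 3 * z := by linear_combination (-1 : ℂ) * e
  rw [this]
  exact Λ.sub_mem hx (by simpa only [zsmul_eq_mul, Int.cast_ofNat] using Λ.smul_mem (3 : ℤ) hz)

/-- **(T14c) a `ℂ`-eigen-relation with integral eigenvalue descends modulo `3Λ`**: `(T φ)(β) = m·φ(β)` in `ℂ` ⇒ `(T φ̄)(β) = m • φ̄(β)` in `ℂ ∕ 3Λ` (any Hecke datum; `redThree` is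
additive). With (T11c′) (`φ = c·per_F` on `Γ̄(q)`, `m = a_ℓ(W₁)`) this is the hypothesis `heig` of (T12′)∕(T13′). [folklore] -/
theorem redThree_op_eq_smul {𝔾 : Type*} [Group 𝔾] {N : Subgroup 𝔾} {ι : Type*} [Fintype ι] (H : HeckeDatum N ι)
    (φ : N → ℂ) (m : ℤ) (β : N) (heig : H.op φ β = (m : ℂ) * φ β) :
    H.op (fun δ => redThree Λ (φ δ)) β = m • redThree Λ (φ β) := by
  rw [HeckeDatum.op_apply] at heig ⊢
  rw [← map_sum, heig, ← zsmul_eq_mul, map_zsmul]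

/-- the conclusion of (OBS) read modulo `3Λ`: «`c·per_F(β) ∈ 3Λ`» is «`ψ̄(β) = 0`». [folklore] -/
theorem redThree_eq_zero_iff {x : ℂ} : redThree Λ x = 0 ↔ ∃ y ∈ Λ, x = 3 * y := by
  rw [redThree_apply, Submodule.Quotient.mk_eq_zero, mem_threeMul_iff]
  constructor <;> rintro ⟨y, hy, h⟩ <;> exact ⟨y, hy, h.symm⟩

end ModThree

/-- **(CHEB) CHEBOTAREV SUPPLY AT `3`** (print input (c) of the certificate, typed): if `ρ̄_{W,3}` is surjective then, avoiding any finite set of primes, there is a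
prime `ℓ ≡ 2 (mod 3)` with `3 ∤ a_ℓ(W)`. PROOF IN PRINT: `GL₂(𝔽₃)` contains `g = (0 1; 1 1)` with `det g = -1`, `tr g = 1`; Chebotarev gives unramified `ℓ ∉ S` with
`ρ̄(Frob_ℓ) ∼ g`, so `ℓ ≡ det ρ̄(Frob_ℓ) = 2 (mod 3)` (mod-`3` cyclotomic character) and `a_ℓ ≡ tr = 1 (mod 3)`. ATTACKABLE IN THE TREE: the model is
`Literature.NumberTheory.EllipticCurves.exists_prime_modEq_one_not_dvd_frobeniusTrace_sub_two` (PROVED from `absoluteGaloisGroup.frobenius_dense` + `chebotarev_artinRep_holds`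
+ `ModNCyclotomicCharacter`), with the class of `g` in place of the class used there; `ℓ ≡ 2 (mod 3)` is what makes an order-`3` element of `PGL₂(𝔽_ℓ)` act on `ℙ¹(𝔽_ℓ)` without
fixed points ((T6): `t² + t + 1` has no root mod `ℓ`), and `3 ∤ a_ℓ` is `ha` of (T4)∕(T13). [cite: SerreChebotarev1981, §8; Serre1972, §5] -/
@[conjecture] def ChebotarevSupplyAtThree : Prop :=
  ∀ (W : WeierstrassCurve ℚ) [W.IsElliptic], W.HasSurjectiveModNGaloisRep 3 → ∀ S : Set ℕ, S.Finite →
    ∃ ℓ : ℕ, ℓ.Prime ∧ ℓ ∉ S ∧ ℓ % 3 = 2 ∧ ¬ (3 : ℤ) ∣ W.LFunction ℓ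

/-- at a prime `ℓ ≡ 2 (mod 3)`, `t² + t + 1` has no root in `ZMod ℓ` — the hypothesis `hirr` of (T6) `fixedPointFree_of_projective_equivariance` (for `ℓ ≠ 3`; `-3` is a
non-residue mod `ℓ ≡ 2 (3)` by quadratic reciprocity). Typed as the statement the (OBS) prover needs; [folklore] -/
def NoCubeRootOfUnityMod (ℓ : ℕ) : Prop := ∀ t : ZMod ℓ, t ^ 2 + t + 1 ≠ 0

/-- sanity instance of `NoCubeRootOfUnityMod`: `ℓ = 5`. [folklore] -/
theorem noCubeRootOfUnityMod_five : NoCubeRootOfUnityMod 5 := by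
  unfold NoCubeRootOfUnityMod; decide

/-- and it FAILS at `ℓ = 7 ≡ 1 (mod 3)` (`t = 2`): the congruence condition in (CHEB) is load-bearing. [folklore] -/
theorem not_noCubeRootOfUnityMod_seven : ¬ NoCubeRootOfUnityMod 7 := by
  unfold NoCubeRootOfUnityMod; decide

/-- **(SIMREP) SIMULTANEOUS HECKE REPRESENTATIVES AT A GOOD PRIME** [PRINT INPUT of the certificate]: for `q ∈ C` and a prime `ℓ ∤ q·D·M·∏_C p`, some
`Γ`-translates `α_i = g_i · q_i.out` (`g_i ∈ Γ = ι(O¹)`) of the tree's representatives of `Γ∖ι(O(ℓ))` are (i) pairwise `ι(O₀'¹)`-inequivalent, (ii) right-`ι(O₀'¹)`-stable,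
(iii) pass the two-sided test for `Γ̄(q)` (every `α_i β α_j⁻¹ ∈ Γ`, `β ∈ Γ̄(q)`, lies in `Γ̄(q)` — all `α_i` have ONE reduction mod `q`, arranged by (M0) since `red(Γ)` is the
norm-one torus and two elements of `𝔽_{q²}^×` of norm `ℓ` differ by a norm-one element), and (iv) represent every `ι(O₀'¹)`-coset of `ι(O₀'(ℓ))` (so the `ofStable` datum IS
`T_ℓ` of the cover). (i)∕(iv): both coset spaces are `ℙ¹(𝔽_ℓ)` via the local component at `ℓ`, where `O_ℓ = O₀'_ℓ` is maximal (class number one ∕ strong approximation).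
Why it might fail: it should not for `ℓ ∤ q·level`; at `ℓ | n_q` the cover order is not maximal at `ℓ` and (i)∕(iv) break. [cite: ShimuraIATAF1971, Prop. 3.36 and §3.3]
[cite: Voight2021, Thm. 28.5.3] [cite: Miyake2006, §5.3] -/
@[conjecture]
def SimultaneousHeckeReps : Prop :=
  ∀ (D M : ℕ) (C : Finset ℕ) (X : CartanLevelCurveData D M C) (q : ℕ) [Fact q.Prime], q ∈ C →
    ∀ (ℓ : ℕ), ℓ.Prime → ¬ ℓ ∣ q * (D * M * ∏ p ∈ C, p) →
      ∃ g : Quotient (X.heckeSetoid ℓ) → GL (Fin 2) ℝ,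
        (∀ i, g i ∈ X.Gamma) ∧
        (∀ (i j : Quotient (X.heckeSetoid ℓ)) (u : GL (Fin 2) ℝ), u ∈ CartanCover.coverUnits X q →
          g i * ((i.out : X.heckeSet ℓ) : GL (Fin 2) ℝ) = u * (g j * ((j.out : X.heckeSet ℓ) : GL (Fin 2) ℝ)) → i = j) ∧
        (∀ u ∈ CartanCover.coverUnits X q, ∀ (i : Quotient (X.heckeSetoid ℓ)), ∃ j : Quotient (X.heckeSetoid ℓ),
          g i * ((i.out : X.heckeSet ℓ) : GL (Fin 2) ℝ) * u * (g j * ((j.out : X.heckeSet ℓ) : GL (Fin 2) ℝ))⁻¹ ∈ CartanCover.coverUnits X q) ∧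
        (∀ β ∈ CartanCover.principalLevel X q, ∀ (i j : Quotient (X.heckeSetoid ℓ)),
          g i * ((i.out : X.heckeSet ℓ) : GL (Fin 2) ℝ) * β * (g j * ((j.out : X.heckeSet ℓ) : GL (Fin 2) ℝ))⁻¹ ∈ X.Gamma →
          g i * ((i.out : X.heckeSet ℓ) : GL (Fin 2) ℝ) * β * (g j * ((j.out : X.heckeSet ℓ) : GL (Fin 2) ℝ))⁻¹ ∈ CartanCover.principalLevel X q) ∧
        (∀ a ∈ unitsHeckeSet X.ι (O := CartanCover.coverOrder X q) ℓ, ∃ (i : Quotient (X.heckeSetoid ℓ)),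
          ∃ u ∈ CartanCover.coverUnits X q, u * a = g i * ((i.out : X.heckeSet ℓ) : GL (Fin 2) ℝ))

end T11c

end InertHecke

end Summit.BirchSwinnertonDyer.BirchSwinnertonDyer.Theorems.CartanCover.Charext

end
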